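import Mathlib
import Summits.ValiantsHypothesis.ValiantsHypothesis.Theorems.BarrierLeverPartitionMinorsHitByVPAdditiveDoubleObstruction

/-!
# Route BarrierLever — item `PartitionMinorsHitByVP` (stmt-ValiantsHypothesis-19717):
# STAR obstructions of the additive door (sub-family cores) — H1 is false in both forms

Helper / negative file (`--supports stmt-ValiantsHypothesis-19717`; cell valiant-natproofs, rung V4,
𝒟-side, prover seat val-np-p6 gen 4). Definition-free. Closes NO item.

`…AdditiveObstruction.additiveMatrix_det_eq_zero_of_hilbert` (p510322) needs a core `C₀ ⊆ w j` common
to ALL columns. The same span argument works for a core common to a SUB-FAMILY only: the columns `j`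
with `C₀ ⊆ w j` and `|w j ∖ C₀| ≤ d` (the STAR of `C₀` of radius `d`) all lie in
`(∏_{c∈C₀} ℓ_c) · V_d`, a space of dimension `H_u(d)`; more than `H_u(d)` of them are dependent.

* **`additiveMatrix_det_eq_zero_of_star`** — if more than `H_u(d)` columns lie in the star of some `C₀`
  (no condition on the other columns), the additive matrix is singular for EVERY table.
* **`additive_star_example_det_eq_zero`** — `h = 5`, rows = the 3-subcube `2^{012}` (8 rows,
  `H_u(1) ≤ 1 + |⋃ u| = 4` by `rank_indicatorsOne_le`), columns `{0},{01},{02},{03},{04},{123},{124},{1234}`: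
  the star of `{0}` of radius 1 has 5 members ⇒ singular for every table, although the GLOBAL Hilbert
  counts of p510322 (core `⋂ w = ∅`: 1 ≤ 1, 1 ≤ 4, 5 ≤ 7, 7 ≤ 8, 8 ≤ 8) all pass. So conjecture H1 of
  HANDOFF § val-np-p6 g3 («the global Hilbert condition is sufficient for a generic table») is false from
  `h = 5`; memo RESIDUE-v6-p6g4.md §2 records that even the all-cores version H1′ is false (two stars
  `{0,0a}` ∪ `{1,1a}` of full size share `ℓ_0 ℓ_1`: `dim (ℓ_0 V_1 + ℓ_1 V_1) ≤ 2 H_u(1) − 1`; numerically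
  singular at `h = 6`). The reach of the additive leaf is a generic-rank condition on a lattice of
  subspaces `ℓ^C · V_d`, not a counting condition; the universal families (cubes as columns, p519710;
  Hamming balls as rows, conjecture T1 of `…BallUniversal`) are the clean statements.

WHAT THIS IS NOT: nothing on item 19717 itself, crux 14610 or VP vs VNP.
-/

set_option linter.dupNamespace false

namespace Summit.ValiantsHypothesis.ValiantsHypothesis.Theorems.BarrierLever.AdditiveDoor

open Finset MvPolynomial

noncomputable section

variable {h : ℕ}

/-- **Star obstruction.** If more than `H_u(d) = rank [[R ⊆ u i]]_{i, |R| ≤ d}` columns `j` satisfy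
`C₀ ⊆ w j` and `|w j ∖ C₀| ≤ d` (for ONE set `C₀`, with no condition on the remaining columns), the
additive matrix is singular for EVERY table. (Proof = p510322's, with the core hypothesis moved into
the column filter.) -/
theorem additiveMatrix_det_eq_zero_of_star {ι : Type*} [Fintype ι] [DecidableEq ι]
    (u w : ι → Finset (Fin h)) (ω₀ : Fin h → ℂ) (ω : Fin h → Fin h → ℂ) (C₀ : Finset (Fin h))
    (d : ℕ)
    (hcount : (Matrix.of fun (i : ι) (R : {R : Finset (Fin h) // R.card ≤ d}) =>
        if R.1 ⊆ u i then (1 : ℂ) else 0).rank <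
      (Finset.univ.filter fun j => C₀ ⊆ w j ∧ (w j \ C₀).card ≤ d).card) :
    (Matrix.of fun i j : ι => ∏ c ∈ w j, (ω₀ c + ∑ a ∈ u i, ω a c)).det = 0 := by
  classical
  set M : Matrix ι ι ℂ := Matrix.of fun i j : ι => ∏ c ∈ w j, (ω₀ c + ∑ a ∈ u i, ω a c) with hM
  set E : Matrix ι {R : Finset (Fin h) // R.card ≤ d} ℂ :=
    Matrix.of fun i R => if R.1 ⊆ u i then (1 : ℂ) else 0 with hE
  -- the span of the indicator columns and its image under the core multiplier
  set V : Submodule ℂ (ι → ℂ) := Submodule.span ℂ (Set.range E.col) with hV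
  set Dmul : (ι → ℂ) →ₗ[ℂ] (ι → ℂ) :=
    { toFun := fun v i => (∏ c ∈ C₀, (ω₀ c + ∑ a ∈ u i, ω a c)) * v i
      map_add' := fun x y => by funext i; simp [mul_add]
      map_smul' := fun r x => by funext i; simp [mul_left_comm] } with hDmul
  set V' : Submodule ℂ (ι → ℂ) := V.map Dmul with hV'
  have hrankV : Module.finrank ℂ V = E.rank := (Matrix.rank_eq_finrank_span_cols E).symm
  have hrankV' : Module.finrank ℂ V' ≤ E.rank := hrankV ▸ Submodule.finrank_map_le _ _
  -- every low-weight column of `M` lies in `V'`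
  have hcol : ∀ j : {j : ι // C₀ ⊆ w j ∧ (w j \ C₀).card ≤ d}, M.col j.1 ∈ V' := by
    intro j
    have hmem := prod_affine_mem_span_indicators u ω₀ ω (w j.1 \ C₀)
    -- transport the span over `{R // card ≤ |w j \ C₀|}` into `V` (cards `≤ d`)
    have hsub : Submodule.span ℂ (Set.range fun R : {R : Finset (Fin h) // R.card ≤ (w j.1 \ C₀).card} =>
        fun i => if R.1 ⊆ u i then (1 : ℂ) else 0) ≤ V := by
      refine Submodule.span_le.mpr ?_
      rintro _ ⟨R, rfl⟩
      refine Submodule.subset_span ⟨⟨R.1, R.2.trans j.2.2⟩, ?_⟩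
      funext i
      simp [hE, Matrix.col]
    have hv : (fun i => ∏ c ∈ w j.1 \ C₀, (ω₀ c + ∑ a ∈ u i, ω a c)) ∈ V := hsub hmem
    have hcolj : M.col j.1 = Dmul (fun i => ∏ c ∈ w j.1 \ C₀, (ω₀ c + ∑ a ∈ u i, ω a c)) := by
      funext i
      simp only [hM, hDmul, Matrix.col_apply, Matrix.of_apply, LinearMap.coe_mk, AddHom.coe_mk]
      rw [← Finset.prod_union (Finset.disjoint_sdiff), Finset.union_sdiff_of_subset j.2.1]
    rw [hcolj]
    exact Submodule.mem_map_of_mem hv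
  -- the linear map `v ↦ Σ_j v_j col_j` on `J → ℂ` lands in `V'`, which is too small
  let Φ : ({j : ι // C₀ ⊆ w j ∧ (w j \ C₀).card ≤ d} → ℂ) →ₗ[ℂ] (ι → ℂ) :=
    { toFun := fun v i => ∑ j : {j : ι // C₀ ⊆ w j ∧ (w j \ C₀).card ≤ d}, v j * M i j.1
      map_add' := fun x y => by funext i; simp [add_mul, Finset.sum_add_distrib]
      map_smul' := fun r x => by funext i; simp [Finset.mul_sum, mul_assoc] }
  have hΦapply : ∀ v i, Φ v i = ∑ j : {j : ι // C₀ ⊆ w j ∧ (w j \ C₀).card ≤ d}, v j * M i j.1 :=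
    fun v i => rfl
  have hΦmem : ∀ v, Φ v ∈ V' := by
    intro v
    have : Φ v = ∑ j : {j : ι // C₀ ⊆ w j ∧ (w j \ C₀).card ≤ d}, v j • M.col j.1 := by
      funext i
      rw [hΦapply]
      simp [Matrix.col_apply, Finset.sum_apply, smul_eq_mul]
    rw [this]
    exact Submodule.sum_mem _ fun j _ => Submodule.smul_mem _ _ (hcol j)
  have hcardJ : Module.finrank ℂ ({j : ι // C₀ ⊆ w j ∧ (w j \ C₀).card ≤ d} → ℂ) =
      (Finset.univ.filter fun j => C₀ ⊆ w j ∧ (w j \ C₀).card ≤ d).card := by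
    rw [Module.finrank_fintype_fun_eq_card, Fintype.card_subtype]
  have hker : LinearMap.ker (LinearMap.codRestrict V' Φ hΦmem) ≠ ⊥ := by
    refine LinearMap.ker_ne_bot_of_finrank_lt ?_
    rw [hcardJ]
    exact lt_of_le_of_lt hrankV' hcount
  obtain ⟨v, hvker, hvne⟩ := (Submodule.ne_bot_iff _).mp hker
  have hΦv : Φ v = 0 := by
    have := congrArg Subtype.val (LinearMap.mem_ker.mp hvker)
    simpa using this
  -- extend `v` by zero and conclude
  refine (Matrix.exists_mulVec_eq_zero_iff).mp
    ⟨fun i => if hi : C₀ ⊆ w i ∧ (w i \ C₀).card ≤ d then v ⟨i, hi⟩ else 0, ?_, ?_⟩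
  · intro hzero
    apply hvne
    funext j
    have := congrFun hzero j.1
    simp only [dif_pos j.2, Pi.zero_apply] at this
    exact this
  · funext i
    have hi : ∑ j : {j : ι // C₀ ⊆ w j ∧ (w j \ C₀).card ≤ d}, v j * M i j.1 = 0 := by
      rw [← hΦapply, hΦv]; rfl
    rw [Matrix.mulVec, dotProduct, Pi.zero_apply]
    calc ∑ j, M i j * (if hj : C₀ ⊆ w j ∧ (w j \ C₀).card ≤ d then v ⟨j, hj⟩ else 0)
        = ∑ j ∈ Finset.univ.filter (fun j => C₀ ⊆ w j ∧ (w j \ C₀).card ≤ d),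
            M i j * (if hj : C₀ ⊆ w j ∧ (w j \ C₀).card ≤ d then v ⟨j, hj⟩ else 0) := by
          refine (Finset.sum_subset (Finset.filter_subset _ _) fun j _ hj => ?_).symm
          have hj' : ¬ (C₀ ⊆ w j ∧ (w j \ C₀).card ≤ d) := by simpa using hj
          rw [dif_neg hj', mul_zero]
      _ = ∑ j : {j : ι // C₀ ⊆ w j ∧ (w j \ C₀).card ≤ d},
            M i j.1 * (if hj : C₀ ⊆ w j.1 ∧ (w j.1 \ C₀).card ≤ d then v ⟨j.1, hj⟩ else 0) :=
          Finset.sum_subtype _ (fun j => by simp) _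
      _ = ∑ j : {j : ι // C₀ ⊆ w j ∧ (w j \ C₀).card ≤ d}, v j * M i j.1 :=
          Fintype.sum_congr _ _ fun j => by rw [dif_pos j.2, mul_comm]
      _ = 0 := hi

/-- **H1 is false: a star inside an unobstructed family.** `h = 5`, rows = the subcube `2^{012}`,
columns `{0},{01},{02},{03},{04},{123},{124},{1234}`: five columns in the radius-1 star of `{0}` but
`H_u(1) ≤ 4`, so the additive matrix is singular for every table. -/
theorem additive_star_example_det_eq_zero (ω₀ : Fin 5 → ℂ) (ω : Fin 5 → Fin 5 → ℂ) :
    (Matrix.of fun i j : Fin 8 =>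
      ∏ c ∈ (![{0}, {0, 1}, {0, 2}, {0, 3}, {0, 4}, {1, 2, 3}, {1, 2, 4}, {1, 2, 3, 4}] :
          Fin 8 → Finset (Fin 5)) j,
        (ω₀ c + ∑ a ∈ (![∅, {0}, {1}, {2}, {0, 1}, {0, 2}, {1, 2}, {0, 1, 2}] :
          Fin 8 → Finset (Fin 5)) i, ω a c)).det = 0 := by
  refine additiveMatrix_det_eq_zero_of_star _ _ ω₀ ω {0} 1 (lt_of_le_of_lt (rank_indicatorsOne_le _) ?_)
  decide

end

end Summit.ValiantsHypothesis.ValiantsHypothesis.Theorems.BarrierLever.AdditiveDoor
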